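import Mathlib
import Summits.KontsevichZagierPeriods.Zeta5Search.BrickPhiFour

/-!
# BrickPhiFive — LEMMA Φ5: `Φ_{n,p}(−j) ≡ 1 + λ_p·q_n(j) (mod p⁵)` for `p ≥ 7` — the Frobenius factor of
the brick kernel one `p`-adic digit deeper, with the SAME scalar and the SAME cubic (cell zeta5-irr)

HONEST FRAMING: systematic search; no irrationality claim unless certified. INSTRUMENT lemma of the ζ(5)
census cell zeta5-irr (HOME `run/shared/lean/pub/zeta5-irr/`; memo `zi-p2/LEMMAS.md` §B8-a″ THEOREM 5 (R3) and
HANDOFF § zi-p2 g10 OWED (3)(α): «LEMMA Φ5 = the same block expansion one power further»; zi-lit g7 (STATUS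
2026-08-26T22:07:53Z): «cite prod_mul_add_modEq_pow_five as LEMMA Φ5 = Φ4 mod p⁵, p ≥ 7, same scalar λ_p, same
q_n(j)»). Nothing here is about ζ(5); no irrationality content; filing moves no rung. Filed by the engine seat
zi-eng (g7), sequel of `BrickPhiFour` (LEMMA Φ4, modulo `p⁴`, `p ≥ 5`).

## The statement

The proof of LEMMA Φ4 (`BrickPhiFour`) uses exactly two arithmetic inputs in `ℤ/p⁴`: the BLOCK LAW
`∏_{0<r<p}(mp + r) ≡ (p−1)! + m(m+1)·Λ_p`, `Λ_p = p·A_{p−2}`, and `Λ_p² ≡ 0`. Since `v_p(Λ_p) ≥ 3` (Wolstenholme),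
`Λ_p² ≡ 0 (mod p^k)` for every `k ≤ 6`, so THE SAME ALGEBRA runs modulo `p^k` whenever the block law holds modulo
`p^k`. This file proves the generic statement (block law modulo `p^k`, `k ≤ 6`, as a hypothesis) and instantiates
it with J. Zhao's block law modulo `p⁵` for `p ≥ 7` (J. Number Theory 123 (2007) Thm 3.2; tree:
`Ljunggren.prod_mul_add_modEq_pow_five`, zi-lit g7): for a prime `p ≥ 7`, `2B ≤ A`, every `n`, every `j ∈ ℤ`,

**`Φ_{n,p}(−j) ≡ 1 + λ_p·q (mod p⁵)`**, `λ_p = p·H_{p−1}`, `q = phiMoment A B n j` (`= q_n(j)` = zi-p2's cubic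
`qBall` for `0 ≤ j ≤ n`) — NO second scalar appears at the fifth digit. Equivalently (zi-p2 g11's `L = 2` probe
variable) `u(j) := (Φ_{n,p}(−j) − 1)/p³ ≡ (H_{p−1}/p²)·q_n(j) (mod p²)` for `p ≥ 7`. At `p = 5` this is FALSE
(`not_modEq_pow_five_five`: kernel `(4,1)`, `n = 1`, `j = 0`, where `Φ_{1,5}(0) − 1 − λ_5·q = 5⁴/6` exactly), in
line with the failure of the block law modulo `5⁵` (tree: `Ljunggren.not_prod_modEq_pow_five_five`).

## What is PROVED here (everything; standard axioms)

* `factorial_mul_num_modEq_den_mul_of_block`, `padicValuation_brickPhi_sub_le_of_block` — LEMMA Φ_k for any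
  `k ≤ 6` under the block law modulo `p^k` (cleared of denominators / over `ℚ` on the tree's `brickPhi`);
* **`factorial_mul_num_modEq_den_mul_pow_five`**, **`padicValuation_brickPhi_sub_le_pow_five`** — LEMMA Φ5
  (`p ≥ 7`): `(p−1)!·W^{A−2B}P₁^BP₂^B ≡ D^A·((p−1)! + Λ_p·q) (mod p⁵)` and
  `Rat.padicValuation p (brickPhi A B p n (−j) − 1 − p·H_{p−1}·q) ≤ exp (−5)`;
* `not_modEq_pow_five_five` — sharpness at `p = 5`.
-/

namespace Summit.KontsevichZagierPeriods.Zeta5Search.BrickPhiFive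

open Finset Nat WithZero
open Summit.KontsevichZagierPeriods.Zeta5Search.FrobeniusFactorisation (prod_filter_not_dvd_eq_prod_prod
  not_dvd_prod_filter_sub_mul)
open Summit.KontsevichZagierPeriods.Zeta5Search.BrickKernelFrobenius (brickPhi)
open Summit.KontsevichZagierPeriods.Zeta5Search.BrickPhiFour (blockMoment phiMoment)
open Literature.NumberTheory.Congruences

/-! ## Nilpotent bookkeeping (as in `BrickPhiFour`) -/

section nilpotent

variable {R : Type*} [CommRing R] {μ : R}

/-- `∏_{b<n}(1 + x_b μ) = 1 + (Σ_{b<n} x_b)·μ` when `μ² = 0`. [folklore] -/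
private theorem prod_one_add_mul (hμ : μ * μ = 0) (x : ℕ → R) (n : ℕ) :
    ∏ b ∈ range n, (1 + x b * μ) = 1 + (∑ b ∈ range n, x b) * μ := by
  induction n with
  | zero => simp
  | succ n ih =>
    rw [Finset.prod_range_succ, ih, Finset.sum_range_succ]
    linear_combination ((∑ b ∈ range n, x b) * x n) * hμ

/-- `(1 + x μ)^k = 1 + k·x·μ` when `μ² = 0`. [folklore] -/
private theorem one_add_mul_pow (hμ : μ * μ = 0) (x : R) (k : ℕ) :
    (1 + x * μ) ^ k = 1 + (k : R) * x * μ := by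
  have h := prod_one_add_mul hμ (fun _ => x) k
  rw [Finset.prod_const, Finset.card_range, Finset.sum_const, Finset.card_range, nsmul_eq_mul] at h
  rw [h]

/-- The assembly identity (see `BrickPhiFour`): with `L² = 0`, `uF = 1`,
`F·[Fⁿᵃ(1 + a m₀ Lu)]·[FⁿB(1 + B m₁ Lu)]·[FⁿB(1 + B m₂ Lu)] = Fⁿ⁽ᵃ⁺²ᴮ⁾(1 + (a+2B) m₃ Lu)·(F + L·q)`,
`q = a m₀ + B m₁ + B m₂ − (a+2B) m₃`. [folklore] -/
private theorem assembly {F L u m₀ m₁ m₂ m₃ : R} (hL : L * L = 0) (hu : u * F = 1) (n a B : ℕ) :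
    F * ((F ^ n) ^ a * (1 + (a : R) * m₀ * (L * u))) * ((F ^ n) ^ B * (1 + (B : R) * m₁ * (L * u))) *
        ((F ^ n) ^ B * (1 + (B : R) * m₂ * (L * u))) =
      (F ^ n) ^ (a + 2 * B) * (1 + ((a + 2 * B : ℕ) : R) * m₃ * (L * u)) *
        (F + L * ((a : R) * m₀ + B * m₁ + B * m₂ - ((a + 2 * B : ℕ) : R) * m₃)) := by
  push_cast
  rw [show (F ^ n) ^ (a + 2 * B) = (F ^ n) ^ a * (F ^ n) ^ B * (F ^ n) ^ B by ring]
  set P : R := (F ^ n) ^ a * (F ^ n) ^ B * (F ^ n) ^ B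
  set α : R := (a : R) * m₀
  set β : R := (B : R) * m₁
  set γ : R := (B : R) * m₂
  set δ : R := ((a : R) + 2 * (B : R)) * m₃
  linear_combination (P * L * (α + β + γ - δ)) * hu +
    (P * (-(δ * (α + β + γ - δ) * u) + F * (α * β + α * γ + β * γ) * u ^ 2 + F * α * β * γ * L * u ^ 3)) * hL

end nilpotent

/-! ## LEMMA Φ_k under the block law modulo `p^k`, `k ≤ 6` -/

section generic

variable {p k : ℕ}

/-- `Λ_p² ≡ 0 (mod p^k)` for `k ≤ 6`, `Λ_p = p·A_{p−2}`: Wolstenholme's `p² ∣ A_{p−2}` (tree: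
`Wolstenholme.sq_dvd_sum_factorial_div`) gives `p⁶ ∣ Λ_p²`. -/
private theorem lambda_mul_lambda (hp : p.Prime) (h3 : 3 < p) (hk : k ≤ 6) :
    ((p * ∑ i ∈ Icc 1 (p - 1), (p - 1)! / i : ℕ) : ZMod (p ^ k)) *
        ((p * ∑ i ∈ Icc 1 (p - 1), (p - 1)! / i : ℕ) : ZMod (p ^ k)) = 0 := by
  obtain ⟨c, hc⟩ := Wolstenholme.sq_dvd_sum_factorial_div hp h3
  have h6 : p ^ 6 = p ^ k * p ^ (6 - k) := by rw [← pow_add, Nat.add_sub_cancel' hk]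
  rw [← Nat.cast_mul, ZMod.natCast_eq_zero_iff, hc]
  exact ⟨p ^ (6 - k) * c ^ 2, by
    calc p * (p ^ 2 * c) * (p * (p ^ 2 * c)) = p ^ 6 * c ^ 2 := by ring
      _ = p ^ k * (p ^ (6 - k) * c ^ 2) := by rw [h6]; ring⟩

/-- … hence `(Λ_p·u)² = 0` in `ℤ/p^k` for every `u`. -/
private theorem lambda_mul_sq (hp : p.Prime) (h3 : 3 < p) (hk : k ≤ 6) (u : ZMod (p ^ k)) :
    ((p * ∑ i ∈ Icc 1 (p - 1), (p - 1)! / i : ℕ) : ZMod (p ^ k)) * u *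
        (((p * ∑ i ∈ Icc 1 (p - 1), (p - 1)! / i : ℕ) : ZMod (p ^ k)) * u) = 0 := by
  linear_combination (u * u) * lambda_mul_lambda hp h3 hk

/-- `(p−1)!` is a unit modulo `p^k`. -/
private theorem exists_inv_factorial (hp : p.Prime) :
    ∃ u : ZMod (p ^ k), u * (((p - 1)! : ℕ) : ZMod (p ^ k)) = 1 := by
  have hc : Nat.Coprime (p - 1)! (p ^ k) := by
    refine Nat.Coprime.pow_right k (Nat.coprime_comm.1 ((Nat.Prime.coprime_iff_not_dvd hp).2 ?_))
    rw [hp.dvd_factorial]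
    have := hp.one_lt
    omega
  exact ⟨(((ZMod.unitOfCoprime _ hc)⁻¹ : (ZMod (p ^ k))ˣ) : ZMod (p ^ k)),
    by rw [← ZMod.coe_unitOfCoprime _ hc, Units.inv_mul]⟩

/-- One block in `ℤ/p^k` under the block law: `∏_{0<r<p}(mp + r) = (p−1)!·(1 + m(m+1)·Λ_p·u)`, `u = ((p−1)!)⁻¹`. -/
private theorem block_eq
    (hblock : ∀ m : ℤ, ∏ i ∈ Icc 1 (p - 1), (m * p + (i : ℤ)) ≡
      ((p - 1)! : ℕ) + m * (m + 1) * p * ((∑ i ∈ Icc 1 (p - 1), (p - 1)! / i : ℕ) : ℤ) [ZMOD (p : ℤ) ^ k])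
    {u : ZMod (p ^ k)} (hu : u * (((p - 1)! : ℕ) : ZMod (p ^ k)) = 1) (m : ℤ) :
    ((∏ r ∈ Icc 1 (p - 1), (m * p + (r : ℤ)) : ℤ) : ZMod (p ^ k)) =
      (((p - 1)! : ℕ) : ZMod (p ^ k)) *
        (1 + ((m * (m + 1) : ℤ) : ZMod (p ^ k)) *
          (((p * ∑ i ∈ Icc 1 (p - 1), (p - 1)! / i : ℕ) : ZMod (p ^ k)) * u)) := by
  set Ap : ℕ := ∑ i ∈ Icc 1 (p - 1), (p - 1)! / i with hAp
  set F : ℕ := (p - 1)! with hF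
  have h := hblock m
  rw [(Nat.cast_pow p k).symm] at h
  have h' := (ZMod.intCast_eq_intCast_iff _ _ (p ^ k)).2 h
  rw [h']
  push_cast
  linear_combination (-((m : ZMod (p ^ k)) * (m + 1) * p * Ap)) * hu

/-- The products of `Φ_{n,p}(−j)` as blocks in `ℤ/p^k`: `∏_{1≤ℓ≤np, p∤ℓ}(cp + ℓ) = ((p−1)!)ⁿ·(1 + M_n(c)·Λ_p·u)`. -/
private theorem cast_prod_filter_eq (hp : p.Prime) (h3 : 3 < p) (hk : k ≤ 6)
    (hblock : ∀ m : ℤ, ∏ i ∈ Icc 1 (p - 1), (m * p + (i : ℤ)) ≡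
      ((p - 1)! : ℕ) + m * (m + 1) * p * ((∑ i ∈ Icc 1 (p - 1), (p - 1)! / i : ℕ) : ℤ) [ZMOD (p : ℤ) ^ k])
    {u : ZMod (p ^ k)} (hu : u * (((p - 1)! : ℕ) : ZMod (p ^ k)) = 1) (n : ℕ) (c : ℤ) :
    ((∏ m ∈ (Icc 1 (n * p)).filter (fun m => ¬ p ∣ m), (c * p + (m : ℤ)) : ℤ) : ZMod (p ^ k)) =
      (((p - 1)! : ℕ) : ZMod (p ^ k)) ^ n *
        (1 + ((blockMoment n c : ℤ) : ZMod (p ^ k)) *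
          (((p * ∑ i ∈ Icc 1 (p - 1), (p - 1)! / i : ℕ) : ZMod (p ^ k)) * u)) := by
  rw [prod_filter_not_dvd_eq_prod_prod hp.pos n (fun m => c * p + (m : ℤ)), Int.cast_prod]
  have hb : ∀ b ∈ range n,
      (((∏ r ∈ Icc 1 (p - 1), (c * p + ((b * p + r : ℕ) : ℤ))) : ℤ) : ZMod (p ^ k)) =
        (((p - 1)! : ℕ) : ZMod (p ^ k)) *
          (1 + ((((c + b) * (c + b + 1) : ℤ)) : ZMod (p ^ k)) *
            (((p * ∑ i ∈ Icc 1 (p - 1), (p - 1)! / i : ℕ) : ZMod (p ^ k)) * u)) := by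
    intro b _
    have e : ∏ r ∈ Icc 1 (p - 1), (c * p + ((b * p + r : ℕ) : ℤ)) =
        ∏ r ∈ Icc 1 (p - 1), ((c + b) * p + (r : ℤ)) :=
      Finset.prod_congr rfl fun r _ => by push_cast; ring
    rw [e]
    exact block_eq hblock hu (c + b)
  rw [Finset.prod_congr rfl hb, Finset.prod_mul_distrib, Finset.prod_const, Finset.card_range,
    prod_one_add_mul (lambda_mul_sq hp h3 hk u) (fun b => ((((c + b) * (c + b + 1) : ℤ)) : ZMod (p ^ k))) n]
  simp only [blockMoment, Int.cast_sum]

/-- **LEMMA Φ_k cleared of denominators, under the block law modulo `p^k` (`k ≤ 6`)**: for a prime `p ≥ 5`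
with `∏_{0<r<p}(mp + r) ≡ (p−1)! + m(m+1)·Λ_p (mod p^k)` for all `m ∈ ℤ`, `2B ≤ A`, every `n`, every `j ∈ ℤ`:
`(p−1)!·W^{A−2B}·P₁^B·P₂^B ≡ D^A·((p−1)! + Λ_p·q) (mod p^k)`, notation of
`BrickPhiFour.factorial_mul_num_modEq_den_mul` (the case `k = 4`, where the block law is Glaisher's). -/
theorem factorial_mul_num_modEq_den_mul_of_block (hp : p.Prime) (h3 : 3 < p) (hk : k ≤ 6)
    (hblock : ∀ m : ℤ, ∏ i ∈ Icc 1 (p - 1), (m * p + (i : ℤ)) ≡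
      ((p - 1)! : ℕ) + m * (m + 1) * p * ((∑ i ∈ Icc 1 (p - 1), (p - 1)! / i : ℕ) : ℤ) [ZMOD (p : ℤ) ^ k])
    {A B : ℕ} (hAB : 2 * B ≤ A) (n : ℕ) (j : ℤ) :
    (((p - 1)! : ℕ) : ℤ) *
        ((((∏ m ∈ (Icc 1 (n * p)).filter (fun m => ¬ p ∣ m), m : ℕ) : ℤ) ^ (A - 2 * B) *
          (∏ m ∈ (Icc 1 (n * p)).filter (fun m => ¬ p ∣ m), (j * p + (m : ℤ))) ^ B *
          (∏ m ∈ (Icc 1 (n * p)).filter (fun m => ¬ p ∣ m), (((n : ℤ) - j) * p + (m : ℤ))) ^ B)) ≡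
      (∏ m ∈ (Icc 1 (n * p)).filter (fun m => ¬ p ∣ m), ((m : ℤ) - j * p)) ^ A *
        ((((p - 1)! : ℕ) : ℤ) +
          ((p * ∑ i ∈ Icc 1 (p - 1), (p - 1)! / i : ℕ) : ℤ) * phiMoment A B n j)
      [ZMOD (p : ℤ) ^ k] := by
  obtain ⟨a, rfl⟩ : ∃ a, A = a + 2 * B := ⟨A - 2 * B, by omega⟩
  obtain ⟨u, hu⟩ := exists_inv_factorial (p := p) (k := k) hp
  have hW : (((∏ m ∈ (Icc 1 (n * p)).filter (fun m => ¬ p ∣ m), m : ℕ)) : ZMod (p ^ k)) =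
      (((p - 1)! : ℕ) : ZMod (p ^ k)) ^ n *
        (1 + ((blockMoment n 0 : ℤ) : ZMod (p ^ k)) *
          (((p * ∑ i ∈ Icc 1 (p - 1), (p - 1)! / i : ℕ) : ZMod (p ^ k)) * u)) := by
    rw [← cast_prod_filter_eq hp h3 hk hblock hu n 0]
    push_cast
    exact Finset.prod_congr rfl fun m _ => by ring
  have hP1 := cast_prod_filter_eq hp h3 hk hblock hu n j
  have hP2 := cast_prod_filter_eq hp h3 hk hblock hu n ((n : ℤ) - j)
  have hD : (((∏ m ∈ (Icc 1 (n * p)).filter (fun m => ¬ p ∣ m), ((m : ℤ) - j * p)) : ℤ) : ZMod (p ^ k)) =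
      (((p - 1)! : ℕ) : ZMod (p ^ k)) ^ n *
        (1 + ((blockMoment n (-j) : ℤ) : ZMod (p ^ k)) *
          (((p * ∑ i ∈ Icc 1 (p - 1), (p - 1)! / i : ℕ) : ZMod (p ^ k)) * u)) := by
    rw [← cast_prod_filter_eq hp h3 hk hblock hu n (-j)]
    congr 1
    exact Finset.prod_congr rfl fun m _ => by ring
  rw [(Nat.cast_pow p k).symm]
  refine (ZMod.intCast_eq_intCast_iff _ _ (p ^ k)).1 ?_
  simp only [Int.cast_mul, Int.cast_pow, Int.cast_add, Int.cast_natCast]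
  rw [hW, hP1, hP2, hD]
  simp only [phiMoment, Int.cast_add, Int.cast_sub, Int.cast_mul, Int.cast_natCast, Nat.add_sub_cancel,
    mul_pow, one_add_mul_pow (lambda_mul_sq hp h3 hk u)]
  linear_combination assembly (m₀ := ((blockMoment n 0 : ℤ) : ZMod (p ^ k)))
    (m₁ := ((blockMoment n j : ℤ) : ZMod (p ^ k))) (m₂ := ((blockMoment n ((n : ℤ) - j) : ℤ) : ZMod (p ^ k)))
    (m₃ := ((blockMoment n (-j) : ℤ) : ZMod (p ^ k))) (lambda_mul_lambda hp h3 hk) hu n a B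

/-- `∏_{1≤ℓ≤np, p∤ℓ}(−1) = 1` for an odd prime `p`. -/
private theorem prod_filter_neg_one {R : Type*} [CommRing R] (hp : p.Prime) (h2 : p ≠ 2) (n : ℕ) :
    ∏ _m ∈ (Icc 1 (n * p)).filter (fun m => ¬ p ∣ m), (-1 : R) = 1 := by
  rw [prod_filter_not_dvd_eq_prod_prod hp.pos n (fun _ => (-1 : R))]
  refine Finset.prod_eq_one fun b _ => ?_
  rw [Finset.prod_const, Nat.card_Icc, show p - 1 + 1 - 1 = p - 1 by omega]
  exact (hp.even_sub_one h2).neg_one_pow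

/-- `v_p(z) ≤ 1` for an integer `z`. [folklore] -/
private theorem padicValuation_intCast_le_one [Fact p.Prime] (z : ℤ) : Rat.padicValuation p (z : ℚ) ≤ 1 := by
  rw [Rat.padicValuation_cast]; exact Int.padicValuation_le_one p z

/-- `v_p(z) = 1` for an integer `z` prime to `p`. [folklore] -/
private theorem padicValuation_intCast_eq_one [Fact p.Prime] {z : ℤ} (hz : ¬ (p : ℤ) ∣ z) :
    Rat.padicValuation p (z : ℚ) = 1 := by
  rw [Rat.padicValuation_cast, Int.padicValuation_eq_one_iff]; exact hz

/-- `v_p((p−1)!) = 1`. [folklore] -/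
private theorem padicValuation_factorial_eq_one [Fact p.Prime] :
    Rat.padicValuation p (((p - 1)! : ℕ) : ℚ) = 1 := by
  have hp : p.Prime := Fact.out
  rw [← Int.cast_natCast]
  refine padicValuation_intCast_eq_one fun h => ?_
  have h' : p ∣ (p - 1)! := Int.natCast_dvd_natCast.1 h
  rw [hp.dvd_factorial] at h'
  have := hp.one_lt
  omega

/-- **LEMMA Φ_k over `ℚ`, under the block law modulo `p^k` (`k ≤ 6`)**: for a prime `p ≥ 5`, `2B ≤ A`, every `n`,
every `j ∈ ℤ`: `v_p(Φ_{n,p}(−j) − 1 − p·H_{p−1}·q) ≥ k`, `q = phiMoment A B n j`, on the tree's `brickPhi`. -/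
theorem padicValuation_brickPhi_sub_le_of_block [Fact p.Prime] (h3 : 3 < p) (hk : k ≤ 6)
    (hblock : ∀ m : ℤ, ∏ i ∈ Icc 1 (p - 1), (m * p + (i : ℤ)) ≡
      ((p - 1)! : ℕ) + m * (m + 1) * p * ((∑ i ∈ Icc 1 (p - 1), (p - 1)! / i : ℕ) : ℤ) [ZMOD (p : ℤ) ^ k])
    {A B : ℕ} (hAB : 2 * B ≤ A) (n : ℕ) (j : ℤ) :
    Rat.padicValuation p
        (brickPhi A B p n (-(j : ℚ)) - 1 - (p : ℚ) * harmonic (p - 1) * (phiMoment A B n j : ℚ)) ≤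
      exp (-(k : ℤ)) := by
  have hp : p.Prime := Fact.out
  have h2 : p ≠ 2 := by omega
  have hmain := (factorial_mul_num_modEq_den_mul_of_block hp h3 hk hblock hAB n j).symm.dvd
  have hpD := not_dvd_prod_filter_sub_mul hp h3 n j
  set W : ℕ := ∏ m ∈ (Icc 1 (n * p)).filter (fun m => ¬ p ∣ m), m with hWdef
  set P₁ : ℤ := ∏ m ∈ (Icc 1 (n * p)).filter (fun m => ¬ p ∣ m), (j * p + (m : ℤ)) with hP₁def
  set P₂ : ℤ := ∏ m ∈ (Icc 1 (n * p)).filter (fun m => ¬ p ∣ m), (((n : ℤ) - j) * p + (m : ℤ)) with hP₂def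
  set D : ℤ := ∏ m ∈ (Icc 1 (n * p)).filter (fun m => ¬ p ∣ m), ((m : ℤ) - j * p) with hDdef
  set F : ℕ := (p - 1)! with hFdef
  set Ap : ℕ := ∑ i ∈ Icc 1 (p - 1), (p - 1)! / i with hApdef
  obtain ⟨c, hc⟩ := hmain
  have e1 : ∏ m ∈ (Icc 1 (n * p)).filter (fun m => ¬ p ∣ m), ((p : ℚ) * (-(j : ℚ)) - (m : ℚ)) = (P₁ : ℚ) := by
    rw [hP₁def, Int.cast_prod, ← one_mul (∏ m ∈ (Icc 1 (n * p)).filter (fun m => ¬ p ∣ m),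
      (((j * p + (m : ℤ) : ℤ)) : ℚ)), ← prod_filter_neg_one (R := ℚ) hp h2 n, ← Finset.prod_mul_distrib]
    exact Finset.prod_congr rfl fun m _ => by push_cast; ring
  have e2 : ∏ m ∈ (Icc 1 (n * p)).filter (fun m => ¬ p ∣ m), ((p : ℚ) * (-(j : ℚ)) + ((n * p : ℕ) : ℚ) + (m : ℚ))
      = (P₂ : ℚ) := by
    rw [hP₂def, Int.cast_prod]
    exact Finset.prod_congr rfl fun m _ => by push_cast; ring
  have e3 : ∏ m ∈ (Icc 1 (n * p)).filter (fun m => ¬ p ∣ m), ((p : ℚ) * (-(j : ℚ)) + (m : ℚ)) = (D : ℚ) := by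
    rw [hDdef, Int.cast_prod]
    exact Finset.prod_congr rfl fun m _ => by push_cast; ring
  have hΦ : brickPhi A B p n (-(j : ℚ)) = (W : ℚ) ^ (A - 2 * B) * (P₁ : ℚ) ^ B * (P₂ : ℚ) ^ B / (D : ℚ) ^ A := by
    rw [brickPhi, e1, e2, e3]
  have hF0 : (F : ℚ) ≠ 0 := by positivity
  have hD0 : (D : ℚ) ≠ 0 := fun h => hpD (by rw [show D = 0 by exact_mod_cast h]; exact dvd_zero _)
  have hharm : (p : ℚ) * harmonic (p - 1) = ((p * Ap : ℕ) : ℚ) / (F : ℚ) := by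
    rw [eq_div_iff hF0]
    have hsum := Wolstenholme.sum_factorial_div p
    rw [← hApdef, ← hFdef] at hsum
    push_cast
    linear_combination (p : ℚ) * hsum.symm
  have hcQ : ((F : ℤ) : ℚ) * ((W : ℚ) ^ (A - 2 * B) * (P₁ : ℚ) ^ B * (P₂ : ℚ) ^ B) -
      (D : ℚ) ^ A * ((F : ℚ) + ((p * Ap : ℕ) : ℚ) * (phiMoment A B n j : ℚ)) = (p : ℚ) ^ k * (c : ℚ) := by
    have h := congrArg (Int.cast : ℤ → ℚ) hc
    push_cast at h ⊢
    linear_combination h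
  have hval : brickPhi A B p n (-(j : ℚ)) - 1 - (p : ℚ) * harmonic (p - 1) * (phiMoment A B n j : ℚ) =
      (p : ℚ) ^ k * (c : ℚ) / ((F : ℚ) * (D : ℚ) ^ A) := by
    rw [hΦ, hharm, eq_div_iff (mul_ne_zero hF0 (pow_ne_zero _ hD0)), ← hcQ]
    field_simp
    push_cast
    ring
  rw [hval, map_div₀, map_mul, map_mul, map_pow, map_pow, Rat.padicValuation_self, padicValuation_factorial_eq_one,
    padicValuation_intCast_eq_one hpD, one_pow, mul_one, div_one, ← exp_nsmul]
  calc exp (k • (-1 : ℤ)) * Rat.padicValuation p (c : ℚ) ≤ exp (k • (-1 : ℤ)) * 1 := by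
        gcongr; exact padicValuation_intCast_le_one c
    _ = exp (-(k : ℤ)) := by rw [mul_one]; simp

end generic

/-! ## LEMMA Φ5: the instance `k = 5`, `p ≥ 7` (Zhao's block law) -/

section five

variable {p : ℕ}

/-- **LEMMA Φ5 cleared of denominators**: for a prime `p ≥ 7`, `2B ≤ A`, every `n`, every `j ∈ ℤ`, notation of
`BrickPhiFour.factorial_mul_num_modEq_den_mul`: `(p−1)!·W^{A−2B}·P₁^B·P₂^B ≡ D^A·((p−1)! + Λ_p·q) (mod p⁵)`
— the SAME scalar `Λ_p = p·A_{p−2}` and the SAME moment `q = phiMoment A B n j` as modulo `p⁴`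
(block law: Zhao 2007 Thm 3.2, tree `Ljunggren.prod_mul_add_modEq_pow_five`). -/
theorem factorial_mul_num_modEq_den_mul_pow_five (hp : p.Prime) (h5 : 5 < p) {A B : ℕ} (hAB : 2 * B ≤ A)
    (n : ℕ) (j : ℤ) :
    (((p - 1)! : ℕ) : ℤ) *
        ((((∏ m ∈ (Icc 1 (n * p)).filter (fun m => ¬ p ∣ m), m : ℕ) : ℤ) ^ (A - 2 * B) *
          (∏ m ∈ (Icc 1 (n * p)).filter (fun m => ¬ p ∣ m), (j * p + (m : ℤ))) ^ B *
          (∏ m ∈ (Icc 1 (n * p)).filter (fun m => ¬ p ∣ m), (((n : ℤ) - j) * p + (m : ℤ))) ^ B)) ≡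
      (∏ m ∈ (Icc 1 (n * p)).filter (fun m => ¬ p ∣ m), ((m : ℤ) - j * p)) ^ A *
        ((((p - 1)! : ℕ) : ℤ) +
          ((p * ∑ i ∈ Icc 1 (p - 1), (p - 1)! / i : ℕ) : ℤ) * phiMoment A B n j)
      [ZMOD (p : ℤ) ^ 5] :=
  factorial_mul_num_modEq_den_mul_of_block hp (by omega) (by norm_num)
    (Ljunggren.prod_mul_add_modEq_pow_five hp h5) hAB n j

/-- **LEMMA Φ5** (zi-p2 HANDOFF § g10 OWED (3)(α); zi-lit g7): for a prime `p ≥ 7`, `2B ≤ A`, every `n`, every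
`j ∈ ℤ`, the Frobenius factor of the brick kernel `(A,B,·)` satisfies `v_p(Φ_{n,p}(−j) − 1 − λ_p·q) ≥ 5`,
`λ_p = p·H_{p−1}`, `q = phiMoment A B n j` (`= qBall A B n j` for `0 ≤ j ≤ n`): `Φ_{n,p}(−j) ≡ 1 + λ_p·q_n(j)
(mod p⁵)` — no second scalar at the fifth digit; false at `p = 5` (`not_modEq_pow_five_five`). -/
theorem padicValuation_brickPhi_sub_le_pow_five [Fact p.Prime] (h5 : 5 < p) {A B : ℕ} (hAB : 2 * B ≤ A)
    (n : ℕ) (j : ℤ) :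
    Rat.padicValuation p
        (brickPhi A B p n (-(j : ℚ)) - 1 - (p : ℚ) * harmonic (p - 1) * (phiMoment A B n j : ℚ)) ≤
      exp (-5) :=
  padicValuation_brickPhi_sub_le_of_block (k := 5) (by omega) (by norm_num)
    (Ljunggren.prod_mul_add_modEq_pow_five Fact.out h5) hAB n j

/-- **Sharpness at `p = 5`**: for Ball's `ζ(3)` kernel `(A,B) = (4,1)`, `n = 1`, `j = 0` the cleared congruence
FAILS modulo `5⁵`: `4!·(24²·24·3024) − 24⁴·(4! + 250·2) = 24⁴·2500 = 24⁴·4·5⁴` (i.e. `Φ_{1,5}(0) − 1 − λ_5·q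
= 126 − 1 − (125/12)·2 = 5⁴/6` has valuation exactly `4`), matching the failure of the block law modulo `5⁵`
(tree: `Ljunggren.not_prod_modEq_pow_five_five`). -/
theorem not_modEq_pow_five_five :
    ¬ ((((5 - 1)! : ℕ) : ℤ) *
        ((((∏ m ∈ (Icc 1 (1 * 5)).filter (fun m => ¬ 5 ∣ m), m : ℕ) : ℤ) ^ (4 - 2 * 1) *
          (∏ m ∈ (Icc 1 (1 * 5)).filter (fun m => ¬ 5 ∣ m), ((0 : ℤ) * (5 : ℕ) + (m : ℤ))) ^ 1 *
          (∏ m ∈ (Icc 1 (1 * 5)).filter (fun m => ¬ 5 ∣ m), ((((1 : ℕ) : ℤ) - 0) * (5 : ℕ) + (m : ℤ))) ^ 1)) ≡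
      (∏ m ∈ (Icc 1 (1 * 5)).filter (fun m => ¬ 5 ∣ m), ((m : ℤ) - 0 * (5 : ℕ))) ^ 4 *
        ((((5 - 1)! : ℕ) : ℤ) + ((5 * ∑ i ∈ Icc 1 (5 - 1), (5 - 1)! / i : ℕ) : ℤ) * phiMoment 4 1 1 0)
      [ZMOD ((5 : ℕ) : ℤ) ^ 5]) := by
  rw [show phiMoment 4 1 1 0 = 2 by simp [phiMoment, blockMoment]]
  decide

/-- … whereas modulo `5⁴` it holds (an instance of `BrickPhiFour.factorial_mul_num_modEq_den_mul`). -/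
example : (((5 - 1)! : ℕ) : ℤ) *
        ((((∏ m ∈ (Icc 1 (1 * 5)).filter (fun m => ¬ 5 ∣ m), m : ℕ) : ℤ) ^ (4 - 2 * 1) *
          (∏ m ∈ (Icc 1 (1 * 5)).filter (fun m => ¬ 5 ∣ m), ((0 : ℤ) * (5 : ℕ) + (m : ℤ))) ^ 1 *
          (∏ m ∈ (Icc 1 (1 * 5)).filter (fun m => ¬ 5 ∣ m), ((((1 : ℕ) : ℤ) - 0) * (5 : ℕ) + (m : ℤ))) ^ 1)) ≡
      (∏ m ∈ (Icc 1 (1 * 5)).filter (fun m => ¬ 5 ∣ m), ((m : ℤ) - 0 * (5 : ℕ))) ^ 4 *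
        ((((5 - 1)! : ℕ) : ℤ) + ((5 * ∑ i ∈ Icc 1 (5 - 1), (5 - 1)! / i : ℕ) : ℤ) * phiMoment 4 1 1 0)
      [ZMOD ((5 : ℕ) : ℤ) ^ 4] :=
  BrickPhiFour.factorial_mul_num_modEq_den_mul (p := 5) (by norm_num) (by norm_num) (by norm_num) 1 0

end five

end Summit.KontsevichZagierPeriods.Zeta5Search.BrickPhiFive
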